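import Mathlib
import HarnessLib
import Summits.CriticalPhenomena.SAWScalingLimit.Theses.SAWRenewalTightness
import Summits.CriticalPhenomena.SAWScalingLimit.Theorems.ShellCrossingBound.Negative.UniformThresholdFalse
import Summits.CriticalPhenomena.SAWScalingLimit.Theorems.ShellCrossingBound.Negative.OfEventualTight
import Literature.Probability.RandomPlanarGeometry.CurveTortuosity

/-!
# Line `pinch-on-a-circle` for the crux `SAWRenewalTightness.ShellCrossingBound` (stmt-CriticalPhenomena-4728)

Skeleton (crux-plan, round 1, planner `cruxplan-stmt-CriticalPhenomena-4728-pinch-on-a-circle`).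
Idea card `Cruxes/ShellCrossingBound/Ideas/pinch-on-a-circle.md` (ideator 2), paired — as all three
triagers recommend — with its service card `socket-comparison.md`; triage `TRIAGE-r1-{1,2,3}.md` (3 × pass).

## The line in one paragraph

The crux lets the traversal threshold `k x ρ R` depend on the shell, so it is EQUIVALENT to
shell-by-shell tightness of the traversal count (`PerShellTight`; `bound_of_perShellTight` PROVED
below, `K = 1`, `λ = 3`).  `k` separate traversals of ONE shell `D(x; ρ₁, R₁)` meet its middle circle
in `k` points, two of which pinch within `4πr/k`, so the curve makes FOUR separate traversals of the
small shell `D(y; 4πr/k, (R₁-ρ₁)/2)` at some point `y` of the circle (`exists_pinch_of_hasTraversals`,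
PROVED below: IVT, pigeonhole in boxes of the argument, chord ≤ arc).  A union bound over a
ONE-dimensional net of `k+1` points of the circle therefore reduces the crux to ITS OWN INEQUALITY AT
`k = 4` with ANY exponent `1 + s > 1` — the two-strand pinch bound `UniformTwoStrandPinch` (UTSP) — and
mesh thresholds depending on the shell are absorbed because below mesh scale the pinch event is EMPTY
(`stub_subMeshNoPinch`, `stub_pinchUnion`).  Socket comparison then quarantines the boundary: by exact
restriction covariance of the `x_c`-law, UTSP in an arbitrary Jordan domain `D` follows from the
two-strand bound at INTERIOR balls of a socketed enlargement `D̂ ⊇ D` (`stub_socketedEnlargement`,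
Schoenflies) divided by one rate-free confinement constant (`stub_socketTransfer`).  What is left open
is named and typed: `stub_bulkTwoStrandPinch` (the interior 4-leg/two-pinch bound for the critical `ℤ²`
SAW with exponent `> 1`; predicted `x₄ = 35/12`; HARDEST) and `stub_confinementPositivity` (the
critical SAW of a big domain stays inside a socketed sub-domain with probability `≥ c > 0`; predicted
value the restriction constant; rate-free).

  ShellCrossingBound
    ⇐ PerShellTight                                   (bound_of_perShellTight, PROVED)
    ⇐ SubMeshNoPinch ∧ UniformTwoStrandPinch          (stub_pinchUnion;  stub_subMeshNoPinch)
    ⇐ SocketedEnlargement ∧ ConfinementPositivity ∧ BulkTwoStrandPinch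
                                                      (stub_socketTransfer; stub_socketedEnlargement,
                                                       stub_confinementPositivity, stub_bulkTwoStrandPinch)

`ShellCrossingBound_of` (no `sorry`) composes the six registered stubs and concludes the crux BY NAME;
`sorry` occurs only inside `stub_*`.  Hypotheses of `ShellCrossingBound_of` are the name-keyed aliases
`Registered.stub_*` (device of `Summits/ABC/ABC/Cruxes/SomeWindowSaving/Lines/inert-box-collapse.lean`).

## Disproof used (`Cruxes/ShellCrossingBound/Disproof.lean`, cdisprove cycle 1; landed `Negative/*` imported above)

* No `_false_without_<H>` theorem exists for this crux (it RESISTS: `shellCrossingBound_iff_eventualTight`,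
  `Negative/OfEventualTight.lean`).  The line honours the disprover's message "content must be put back
  by fixing the threshold": it is put back as `k = 4` (UTSP / `BulkTwoStrandPinch`), not via `T′`.
* `Negative.not_uniformThreshold` (`UniformThresholdFalse.lean`, witness `Forcing.forcingDomain`: shells
  forced near the marked point `a = 0`): no stub is an instance — `BulkTwoStrandPinch` only speaks of
  balls `closedBall y (2R) ⊆ Ω` (no boundary forcing inside), `UniformTwoStrandPinch` keeps centres at
  distance `≥ d` from BOTH marked points with `C, s, R₀, δ₀` depending on `d` (at distance `≥ d` from `a`
  the witness corridor forces double passages only at aspect ratio bounded below in terms of `d`, absorbed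
  by `C(d)`; for a general Jordan domain a cross-cut separating `a` from `b` at distance `≥ d` from `{a,b}`
  has length `≥ w(D,d) > 0`, its endpoints lying on the two different boundary arcs — checked by all three
  triagers), and the thresholds of `PerShellTight` are shell-dependent, which is exactly the freedom §2 of
  the Disproof shows the crux has.
* Repair pair of Disproof §5: `BulkTwoStrandPinch` is `ShellCrossingBoundBulk` with the threshold FIXED to
  `4` (the disprover's predicted minimal value; `3` is false at the interior start `δ·a_δ`) and the
  exponent requirement LOWERED from `> 2` to `> 1` (the price of AB's two-dimensional net of shells is paid
  by the one-dimensional net on the circle instead), plus a collar `closedBall y (2R) ⊆ Ω` and `R ≤ R₀`.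
* Negatives index (`ledger negatives`): stmt-0772 (all-`δ` tightness) — every statement here keeps
  `δ ≤ δ₀`; nothing else nearby.

## Triage sharpenings acted on
* T1/T2/T3 "close the union bound; outer radius `min((R-ρ)/10, R₀ d)`": `stub_pinchUnion` is stated with
  UTSP in the weak quantifier order (`∀ d, ∃ δ₀ C s R₀`) that the socket transfer actually delivers, and
  the absorption of `d`-dependent mesh thresholds is made an explicit lattice lemma `stub_subMeshNoPinch`.
* T3/T2 "the docstring claim 'empty for η < δ/2' is false by corner clipping": corrected — emptiness is
  claimed only for `η < δ/4 ∧ 2η < R` (`SubMeshNoPinch`; a corner clip needs `R < √2 η`).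
* T1/T2/T3 "the confinement/transfer events must be walk-of-`D'_δ` events (vertices AND edges), and
  `meshDomain D' δ ⊆ meshDomain D δ` only eventually": `staysIn` is the edge event; nesting is part of
  `stub_socketTransfer` (tree: `JordanDomain.exists_forall_mem_meshDomain_and_reachable`).
* T2 Beurling remark: near `∂Ω` the FIRST passage has exponent `≤ 1` uniformly (`= 1` at slit tips), so an
  exponent `> 1` uniformly up to the boundary can only come from the PAIR; the line sidesteps this entirely —
  after socket transfer no estimate is ever made at a boundary point (`BulkTwoStrandPinch` is interior).
-/

noncomputable section

open MeasureTheory Set Metric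
open Literature.Probability.RandomPlanarGeometry Literature.Probability.LatticeModels
open Summit.CriticalPhenomena.SAWScalingLimit.Theses.SAWRenewalTightness (ShellCrossingBound)

namespace Summit.CriticalPhenomena.SAWScalingLimit.Cruxes.ShellCrossingBound.PinchOnACircle

/-! ## §0 Vocabulary of the line -/

/-- The law-mass of the Aizenman–Burchard event "`D(y; η, R)` is traversed by `k` separate segments
of the SAW polyline" under the critical SAW law of `(D; a_δ, b_δ)` at mesh `δ` (verbatim the set of the
crux, with general `k, y, η, R`). [ideator 2, `SketchIdeator2.lean`] -/
def travMass (D : DobrushinDomain) (a b : ℝ → Site 2) (δ : ℝ) (k : ℕ) (y : ℂ) (η R : ℝ) :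
    ENNReal :=
  SAW.law D.carrier δ (a δ) (b δ)
    {γ | (⟨γ.walk.toCurve (meshPoint δ)⟩ : Curve ℂ).HasTraversals k y η R}

/-- The SAW `γ` of `Ω_δ` is also a walk of the discrete domain `Ω'_δ`: every EDGE of `γ` is an edge
of `discreteDomainGraph Ω' δ` (so consecutive vertices lie in `meshDomain Ω' δ` AND the closed lattice
segment between them lies in `closure Ω'` — the walk-of-`Ω'_δ` event the triage asked for; the vertex
event `∀ v ∈ support, v ∈ meshDomain Ω' δ` is strictly weaker for wild `Ω'`).  For such `γ`,
`γ.walk.transfer` is a SAW of `Ω'_δ` with the same support, length and polyline. [folklore] -/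
def staysIn (Ω' : Set ℂ) (δ : ℝ) {Ω : Set ℂ} {a b : Site 2} (γ : SAW.DomainSAW Ω δ a b) : Prop :=
  ∀ e ∈ γ.walk.edges, e ∈ (discreteDomainGraph Ω' δ).edgeSet

/-- **Per-shell tightness** of the traversal count: for every FIXED shell `D(x; ρ, R)` the number of
separate traversals is bounded in probability uniformly in the mesh `δ ≤ min δ₀ ρ` — no uniformity over
shells.  Equivalent to the crux (`bound_of_perShellTight` below and Disproof §2). [ideator 2] -/
def PerShellTight : Prop :=
  ∀ (D : DobrushinDomain) (a b : ℝ → Site 2), SAW.IsEndpointApprox D a b →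
    ∃ δ₀ : ℝ, 0 < δ₀ ∧ ∀ (x : ℂ) (ρ R : ℝ), 0 < ρ → ρ < R →
      ∀ ε : ℝ, 0 < ε → ∃ k : ℕ, ∀ δ ∈ Set.Ioc (0 : ℝ) δ₀, δ ≤ ρ →
        travMass D a b δ k x ρ R ≤ ENNReal.ofReal ε

/-- **UTSP — the uniform two-strand pinch bound** (the crux's own inequality at `k = 4` with ANY
exponent `1 + s > 1`): for centres `y` at distance `≥ d` from both marked points and outer radii
`R ≤ R₀`, `P_δ[4 separate traversals of D(y; η, R)] ≤ C (η/R)^{1+s}`, the constants `δ₀, C, s, R₀`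
depending on `(D, a, b, d)`.  QUANTIFIER ORDER `∀ d, ∃ δ₀ …` (weaker than the card's Sketch, which had
`∃ δ₀, ∀ d`): this is what the socket transfer delivers (the enlargement depends on `d`), and the union
bound absorbs `d`-dependent mesh thresholds by `SubMeshNoPinch`.  Four traversals = two separate visits
to `closedBall y η` separated by an excursion beyond distance `R` (both endpoints being far for small
`δ`); for moderate `δ ≤ δ₀` the start `δ·a_δ` may lie inside `B(y, R)` (then 4 traversals cost two
RETURNS, predicted `(η/R)^{x₅-x₁} = (η/R)^{9/2}`, Disproof §5).  Predicted exponents (Coulomb gas,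
Duplantier–Saleur `x_L = (9L²-4)/48`, surface `x̃_L = L(3L+2)/8`): bulk `x₄ = 35/12`, flat boundary `7`,
needle tip `35/12`, free-strand heuristic `2x₂ = 4/3`; all `> 1`.  No arm bound of any kind is proved
for the planar SAW (KS17 §4; DuminilCopinHammond2013) — this is the open content of the line, reduced
further below to interior balls. [ideator 2; AizenmanBurchardDuke1999 §1.b, Lemma 3.1] -/
def UniformTwoStrandPinch : Prop :=
  ∀ (D : DobrushinDomain) (a b : ℝ → Site 2), SAW.IsEndpointApprox D a b →
    ∀ d : ℝ, 0 < d → ∃ (δ₀ C s R₀ : ℝ), 0 < δ₀ ∧ 0 < s ∧ 0 < R₀ ∧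
      ∀ δ ∈ Set.Ioc (0 : ℝ) δ₀, ∀ (y : ℂ) (η R : ℝ),
        d ≤ dist y (D.pt 0) → d ≤ dist y (D.pt 1) → 0 < η → η < R → R ≤ R₀ →
          travMass D a b δ 4 y η R ≤ ENNReal.ofReal (C * (η / R) ^ (1 + s))

/-- **The interior two-strand pinch bound** (HARDEST stub's statement): the UTSP inequality for balls
with a collar inside the domain, `closedBall y (2R) ⊆ Ω`, radii `R ≤ R₀`, constants depending on
`(D, a, b)` only.  = Disproof §5 `ShellCrossingBoundBulk` with the threshold FIXED to `k₀ = 4` (its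
predicted minimal admissible value; `3` fails at the interior start) and the exponent demand LOWERED from
`> 2` to `> 1` (bulk prediction `x₄ = 35/12`, margin `1.9`; even two INDEPENDENT passages,
`2·x₂ = 4/3`, clear it — the mutual repulsion of the two strands need not be priced).  Immune to
boundary forcing (`Ω ∖ closedBall y R` is connected for a Jordan `Ω`, so no traversal inside the collar
is ever forced); uniformity over the position of the ball inside a FIXED domain is the usual
quasi-locality bet for the critical SAW (no FKG/RSW available: barrier-level fact). BFACF data of the
crux's own measure (unit square, mesh 1/64, `ToyDataIdeator2.md`): two-pass frequency vs inner radius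
has log–log slope `2.2–3.0` (overall `2.56`, prediction `2.92`, threshold `1`). [ideator 2 + Disproof §5] -/
def BulkTwoStrandPinch : Prop :=
  ∀ (D : DobrushinDomain) (a b : ℝ → Site 2), SAW.IsEndpointApprox D a b →
    ∃ (δ₀ C s R₀ : ℝ), 0 < δ₀ ∧ 0 < s ∧ 0 < R₀ ∧
      ∀ δ ∈ Set.Ioc (0 : ℝ) δ₀, ∀ (y : ℂ) (η R : ℝ),
        Metric.closedBall y (2 * R) ⊆ D.carrier → 0 < η → η < R → R ≤ R₀ →
          travMass D a b δ 4 y η R ≤ ENNReal.ofReal (C * (η / R) ^ (1 + s))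

/-- **Confinement positivity** (card socket-comparison, re-typed on the walk-of-`D'_δ` event as the
triage required): for Dobrushin domains `D' ⊆ D` with the same marked points which COINCIDE inside the
two socket balls `B(a, d) ∪ B(b, d)` (`D ∩ sockets ⊆ D'`), and lattice endpoints approximating the marked
points in `D'`, the critical SAW of the BIG domain is a walk of the small discrete domain `D'_δ` with
probability `≥ c > 0` for all small `δ`.  Rate-free; `c, δ₀` per pair; predicted value = the
`SLE_{8/3}` restriction constant (LSW03) — e.g. `(√2-1)^{5/4} = 0.332` for the band `|y-1/2| ≤ 1/4` of
the unit square with the side midpoints marked (BFACF: `0.44 / 0.40 / 0.28–0.32` at meshes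
`1/16, 1/32, 1/64`).  Honest status: an RSW-type LOWER bound at `x_c` (none is known on `ℤ²` at any
scale), in the weakest form in which one can enter; implied by `SAWScalingLimit` itself (portmanteau
on the open event + restriction positivity), hence not refutable short of the conjunct.  The prover
chooses `δ₀` below the nesting threshold `D'_δ ≤ D_δ` and the reachability threshold of
`IsEndpointApprox`, so the law is a probability measure there. [ideator 2, card socket-comparison;
LawlerSchrammWerner2003Restriction; LawlerSchrammWerner2004SAW §3] -/
def ConfinementPositivity : Prop :=
  ∀ (D D' : DobrushinDomain) (a b : ℝ → Site 2) (d : ℝ), 0 < d →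
    D'.carrier ⊆ D.carrier → D'.pt 0 = D.pt 0 → D'.pt 1 = D.pt 1 →
    D.carrier ∩ (Metric.ball (D.pt 0) d ∪ Metric.ball (D.pt 1) d) ⊆ D'.carrier →
    SAW.IsEndpointApprox D' a b →
      ∃ c δ₀ : ℝ, 0 < c ∧ 0 < δ₀ ∧ ∀ δ ∈ Set.Ioc (0 : ℝ) δ₀,
        ENNReal.ofReal c ≤ SAW.law D.carrier δ (a δ) (b δ) {γ | staysIn D'.carrier δ γ}

/-- **Socketed enlargement with room** (the geometric lemma of card socket-comparison, made exact):
every Dobrushin domain `D` sits inside a Dobrushin domain `D'` with the SAME marked points, coinciding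
with `D` inside the socket balls of radius `d/2`, and containing a UNIFORM collar `closedBall z ε` around
every point `z ∈ closure D` at distance `≥ d` from both marked points (so such points are interior
points of `D'`, quantitatively).  Construction (provable now): Schoenflies homeomorphism `H : ℂ ≃ₜ ℂ`
with `H(𝔻) = D`, `H(∂𝔻) = ∂D` (`JordanDomain.exists_homeomorph_eqOn_frontier`); `K := H⁻¹(S) ∩ {1 ≤ ‖w‖}`
for `S = closedBall a (d/2) ∪ closedBall b (d/2)`; star domain `G = {r e^{iθ} : r < ρ θ}` with
`ρ θ = 1 + min 1 (infDist (e^{iθ}) K / 2)` (continuous, `= 1` exactly where `H(e^{iθ}) ∈ S`);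
`D' := G.map H` (`MarkedDomain.map`, marks at the preimages of `a, b`, where `ρ = 1`).  Then
`D ⊆ D'`, `D' ∖ closure D = H {1 < r < ρ θ}` misses `S` (else `infDist ≤ r - 1 < ρ θ - 1 ≤ infDist/2`),
and `∂D' = H(Γ)` is a compact set disjoint from the compact `closure D ∖ (ball a d ∪ ball b d)`
(its circle part maps into `S`, the rest into `(closure D)ᶜ`), whence a uniform `ε`. [card socket-comparison; folklore] -/
def SocketedEnlargement : Prop :=
  ∀ (D : DobrushinDomain) (d : ℝ), 0 < d →
    ∃ (D' : DobrushinDomain) (ε : ℝ), 0 < ε ∧ D.carrier ⊆ D'.carrier ∧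
      D'.pt 0 = D.pt 0 ∧ D'.pt 1 = D.pt 1 ∧
      D'.carrier ∩ (Metric.ball (D.pt 0) (d / 2) ∪ Metric.ball (D.pt 1) (d / 2)) ⊆ D.carrier ∧
      ∀ z ∈ closure D.carrier, d ≤ dist z (D.pt 0) → d ≤ dist z (D.pt 1) →
        Metric.closedBall z ε ⊆ D'.carrier

/-- **Sub-mesh emptiness of the pinch event** (deterministic lattice geometry; the fact behind "no mesh
clause on the inner radius", stated as the triage corrected it): for a SAW `γ` of any `Ω_δ` (`δ > 0`)
and a ball of radius `η < δ/4`, the grid `δℤ²` meets `closedBall y η` in at most one horizontal and one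
vertical chord, both on edges at one vertex `v`; since `γ` visits `v` at most once, `γ⁻¹(closedBall y η)`
is an interval, or (corner clip, `v ∉ closedBall y η`, `dist v y ≤ √2 η`) two intervals between which
`γ` stays within `√2 η < 2η < R` of `y`.  Either way no point at distance `≥ R` is visited between the
first and the last time in the small ball, which caps the number of SEPARATE traversals of `D(y; η, R)`
at `2` (one inward, one outward).  So three — a fortiori four — traversals are impossible.
Size M (unpacking the dyadic `Path.trans` parametrisation of `SimpleGraph.Walk.toCurve`/`polyline`;
cf. the IVT bookkeeping of `Negative/Forcing6Shell.lean`). [triage r1-2/r1-3 cross-cutting note 4; folklore] -/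
def SubMeshNoPinch : Prop :=
  ∀ (Ω : Set ℂ) (δ : ℝ) (a b : Site 2) (γ : SAW.DomainSAW Ω δ a b) (y : ℂ) (η R : ℝ),
    0 < δ → η < δ / 4 → 2 * η < R →
      ¬ (⟨γ.walk.toCurve (meshPoint δ)⟩ : Curve ℂ).HasTraversals 3 y η R

/-- Statement of the union-bound stub: sub-mesh emptiness and UTSP give per-shell tightness. -/
def PinchUnion : Prop :=
  SubMeshNoPinch → UniformTwoStrandPinch → PerShellTight

/-- Statement of the transfer stub: enlargement + confinement + interior bound give UTSP. -/
def SocketTransfer : Prop :=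
  SocketedEnlargement → ConfinementPositivity → BulkTwoStrandPinch → UniformTwoStrandPinch

/-! ## §1 The pigeonhole-on-a-circle lemma (PROVED — ideator 2, `SketchIdeator2.lean`, verbatim) -/

section Pinch

open Complex Real
open scoped unitInterval

/-- Intermediate value on a traversal: the segment passes through the middle sphere at a time
strictly after its start. [ideator 2] -/
theorem exists_mem_sphere_of_isTraversal {γ : Curve ℂ} {x : ℂ} {ρ₁ R₁ r : ℝ} {s t : I}
    (hρr : ρ₁ < r) (hrR : r < R₁) (h : γ.IsTraversal x ρ₁ R₁ s t) :
    ∃ m : I, s < m ∧ m ≤ t ∧ dist (γ m) x = r := by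
  classical
  set g : ℝ → ℝ := fun u => dist (γ (Set.projIcc (0 : ℝ) 1 zero_le_one u)) x with hg
  have hgc : Continuous g := (γ.continuous.comp continuous_projIcc).dist continuous_const
  have hgs : g s = dist (γ s) x := by simp [hg, Set.projIcc_val]
  have hgt : g t = dist (γ t) x := by simp [hg, Set.projIcc_val]
  have hst : (s : ℝ) ≤ t := h.1
  have hmem : r ∈ g '' Set.Icc (s : ℝ) t := by
    rcases h.2 with ⟨hs, ht⟩ | ⟨hs, ht⟩
    · exact intermediate_value_Icc hst hgc.continuousOn ⟨by rw [hgs]; linarith, by rw [hgt]; linarith⟩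
    · exact intermediate_value_Icc' hst hgc.continuousOn ⟨by rw [hgt]; linarith, by rw [hgs]; linarith⟩
  obtain ⟨c, ⟨hsc, hct⟩, hgc'⟩ := hmem
  have hc01 : c ∈ Set.Icc (0 : ℝ) 1 := ⟨s.2.1.trans hsc, hct.trans t.2.2⟩
  refine ⟨⟨c, hc01⟩, ?_, ?_, ?_⟩
  · rcases eq_or_lt_of_le (show s ≤ (⟨c, hc01⟩ : I) from hsc) with heq | hlt
    · exfalso
      have : g c = dist (γ s) x := by rw [← hgs]; congr 1; exact congrArg Subtype.val heq.symm
      rcases h.2 with ⟨hs, -⟩ | ⟨hs, -⟩ <;> linarith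
    · exact hlt
  · exact hct
  · have : g c = dist (γ ⟨c, hc01⟩) x := by simp [hg, Set.projIcc_of_mem _ hc01]
    rw [← this, hgc']

/-- Just before a time `m > s` the curve is close to `γ m` (continuity). [ideator 2] -/
theorem exists_lt_dist_lt (γ : Curve ℂ) {s m : I} (hsm : s < m) {ε : ℝ} (hε : 0 < ε) :
    ∃ m' : I, s ≤ m' ∧ m' < m ∧ dist (γ m') (γ m) < ε := by
  obtain ⟨δ, hδ, hδε⟩ := Metric.continuousAt_iff.1 (γ.continuous.continuousAt (x := m)) ε hε
  have hsm' : (s : ℝ) < m := hsm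
  set c : ℝ := max (s : ℝ) ((m : ℝ) - δ / 2) with hc
  have hcm : c < m := max_lt hsm' (by linarith)
  have hc01 : c ∈ Set.Icc (0 : ℝ) 1 := ⟨s.2.1.trans (le_max_left _ _), hcm.le.trans m.2.2⟩
  refine ⟨⟨c, hc01⟩, ?_, hcm, hδε ?_⟩
  · show (s : ℝ) ≤ c
    rw [hc]; exact le_max_left _ _
  rw [Subtype.dist_eq, Real.dist_eq, abs_sub_comm, abs_of_pos (by simpa using hcm)]
  have : (m : ℝ) - δ / 2 ≤ c := le_max_right _ _
  show (m : ℝ) - c < δ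
  linarith

/-- Endpoints of a traversal of `D(x; ρ₁, R₁)` are far from every point of the middle sphere. [ideator 2] -/
theorem le_dist_of_endpoint {q x y : ℂ} {ρ₁ R₁ : ℝ} (hy : dist y x = (ρ₁ + R₁) / 2)
    (hq : dist q x ≤ ρ₁ ∨ R₁ ≤ dist q x) : (R₁ - ρ₁) / 2 ≤ dist q y := by
  rcases hq with hq | hq
  · have := dist_triangle y q x
    rw [dist_comm y q] at this
    linarith
  · have := dist_triangle q y x
    linarith

/-- Pigeonhole on a circle: among `k ≥ 2` points of the sphere of radius `r > 0` about `x`, two (with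
ordered indices) are at distance `< 4πr/k`. [ideator 2] -/
theorem exists_lt_dist_lt_of_mem_sphere {k : ℕ} (hk : 2 ≤ k) {x : ℂ} {r : ℝ} (hr : 0 < r)
    (p : Fin k → ℂ) (hp : ∀ i, dist (p i) x = r) :
    ∃ i j : Fin k, i < j ∧ dist (p i) (p j) < 4 * π * r / k := by
  classical
  have hk1 : (0 : ℝ) < (k : ℝ) - 1 := by
    have : (2 : ℝ) ≤ k := by exact_mod_cast hk
    linarith
  set w : ℝ := 2 * π / ((k : ℝ) - 1) with hw
  have hwpos : 0 < w := div_pos (by positivity) hk1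
  set val : Fin k → ℝ := fun i => (arg (p i - x) + π) / w with hval
  have hval0 : ∀ i, 0 ≤ val i := fun i => by
    have := (arg_mem_Ioc (p i - x)).1
    exact div_nonneg (by linarith) hwpos.le
  have hvalk : ∀ i, val i ≤ (k : ℝ) - 1 := fun i => by
    have h2 := (arg_mem_Ioc (p i - x)).2
    rw [hval, div_le_iff₀ hwpos, hw]
    field_simp
    nlinarith [Real.pi_pos]
  set b : Fin k → ℕ := fun i => min ⌊val i⌋₊ (k - 2) with hb
  have hbox : ∀ i, (b i : ℝ) ≤ val i ∧ val i ≤ b i + 1 := by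
    intro i
    by_cases hle : ⌊val i⌋₊ ≤ k - 2
    · have hbi : b i = ⌊val i⌋₊ := by simp [hb, hle]
      rw [hbi]
      exact ⟨Nat.floor_le (hval0 i), (Nat.lt_floor_add_one (val i)).le⟩
    · have hbi : b i = k - 2 := by simp [hb, (not_le.1 hle).le]
      rw [hbi]
      refine ⟨?_, ?_⟩
      · have h1 : ((k - 2 : ℕ) : ℝ) ≤ (⌊val i⌋₊ : ℝ) := by exact_mod_cast (not_le.1 hle).le
        exact h1.trans (Nat.floor_le (hval0 i))
      · have h2 : ((k - 2 : ℕ) : ℝ) = (k : ℝ) - 2 := by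
          rw [Nat.cast_sub hk]; norm_num
        rw [h2]; linarith [hvalk i]
  have hmaps : ∀ i ∈ (Finset.univ : Finset (Fin k)), b i ∈ Finset.range (k - 1) := by
    intro i _
    rw [Finset.mem_range]
    have : b i ≤ k - 2 := min_le_right _ _
    omega
  have hcard : (Finset.range (k - 1)).card < (Finset.univ : Finset (Fin k)).card := by
    simp; omega
  obtain ⟨i, -, j, -, hij, hbij⟩ := Finset.exists_ne_map_eq_of_card_lt_of_maps_to hcard hmaps
  have hang : |arg (p i - x) - arg (p j - x)| ≤ w := by
    have h1 := hbox i; have h2 := hbox j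
    rw [hbij] at h1
    have hv : |val i - val j| ≤ 1 := by rw [abs_le]; constructor <;> linarith [h1.1, h1.2, h2.1, h2.2]
    have : arg (p i - x) - arg (p j - x) = w * (val i - val j) := by
      simp only [hval]; field_simp; ring
    rw [this, abs_mul, abs_of_pos hwpos]
    calc w * |val i - val j| ≤ w * 1 := by gcongr
      _ = w := mul_one w
  have hpi : ∀ l, p l - x = (r : ℂ) * Complex.exp (arg (p l - x) * Complex.I) := fun l => by
    have h := norm_mul_exp_arg_mul_I (p l - x)
    have hn : ‖p l - x‖ = r := by rw [← dist_eq_norm]; exact hp l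
    rw [hn] at h
    exact h.symm
  have hdist : dist (p i) (p j) ≤ r * w := by
    rw [dist_eq_norm, show p i - p j = (p i - x) - (p j - x) by ring, hpi i, hpi j, ← mul_sub,
      norm_mul, Complex.norm_real, Real.norm_eq_abs, abs_of_pos hr]
    gcongr
    exact (norm_exp_mul_I_sub_exp_mul_I_le _ _).trans hang
  have hdist2 : dist (p i) (p j) ≤ 2 * r := by
    have := dist_triangle (p i) x (p j)
    rw [hp i, dist_comm x (p j), hp j] at this
    linarith
  have hlt : dist (p i) (p j) < 4 * π * r / k := by
    have hkpos : (0 : ℝ) < k := by linarith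
    rcases eq_or_lt_of_le hk with h2 | h3
    · subst h2
      rw [lt_div_iff₀ hkpos]
      push_cast
      nlinarith [Real.pi_gt_three, hdist2, hr]
    · have h3' : (3 : ℝ) ≤ k := by exact_mod_cast h3
      refine hdist.trans_lt ?_
      rw [hw, lt_div_iff₀ hkpos]
      rw [show r * (2 * π / ((k : ℝ) - 1)) * k = (2 * π * r * k) / ((k : ℝ) - 1) by ring,
        div_lt_iff₀ hk1]
      have hpr : 0 < π * r := mul_pos Real.pi_pos hr
      nlinarith [hpr, h3']
  rcases lt_or_gt_of_ne hij with h | h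
  · exact ⟨i, j, h, hlt⟩
  · exact ⟨j, i, h, by rwa [dist_comm]⟩

/-- **Pigeonhole on the middle circle** (the lever of the card): `k ≥ 2` separate traversals of
`D(x; ρ₁, R₁)` force FOUR separate traversals of `D(y; 4πr/k, (R₁-ρ₁)/2)` for some `y` with
`|y - x| = r = (ρ₁ + R₁)/2`. [ideator 2, PROVED] -/
theorem exists_pinch_of_hasTraversals {γ : Curve ℂ} {x : ℂ} {ρ₁ R₁ : ℝ} {k : ℕ}
    (hρ : 0 ≤ ρ₁) (hR : ρ₁ < R₁) (hk : 2 ≤ k) (h : γ.HasTraversals k x ρ₁ R₁) :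
    ∃ y : ℂ, dist y x = (ρ₁ + R₁) / 2 ∧
      γ.HasTraversals 4 y (4 * Real.pi * ((ρ₁ + R₁) / 2) / k) ((R₁ - ρ₁) / 2) := by
  classical
  obtain ⟨s, t, hst, hsep⟩ := h
  set r : ℝ := (ρ₁ + R₁) / 2 with hr
  set R'' : ℝ := (R₁ - ρ₁) / 2 with hR''
  set η : ℝ := 4 * Real.pi * r / k with hη
  have hρr : ρ₁ < r := by rw [hr]; linarith
  have hrR : r < R₁ := by rw [hr]; linarith
  have hrpos : 0 < r := by linarith
  have hm : ∀ i, ∃ m : I, s i < m ∧ m ≤ t i ∧ dist (γ m) x = r := fun i =>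
    exists_mem_sphere_of_isTraversal hρr hrR (hst i)
  choose m hsm hmt hmr using hm
  obtain ⟨i₀, j₀, hij, hd⟩ :=
    exists_lt_dist_lt_of_mem_sphere hk hrpos (fun i => γ (m i)) hmr
  have hηpos : 0 < η := by
    have hkpos : (0 : ℝ) < k := by have : (2:ℝ) ≤ k := by exact_mod_cast hk
                                   linarith
    rw [hη]; positivity
  set y : ℂ := γ (m i₀) with hy
  obtain ⟨m₁, hsm₁, hm₁m, hd₁⟩ := exists_lt_dist_lt γ (hsm i₀) hηpos
  obtain ⟨m₂, hsm₂, hm₂m, hd₂⟩ := exists_lt_dist_lt γ (hsm j₀) (sub_pos.2 hd)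
  have hd₂' : dist (γ m₂) y ≤ η := by
    have := dist_triangle (γ m₂) (γ (m j₀)) y
    rw [hy] at this ⊢
    have hcomm : dist (γ (m j₀)) (γ (m i₀)) = dist (γ (m i₀)) (γ (m j₀)) := dist_comm _ _
    linarith
  have hfar : ∀ i, R'' ≤ dist (γ (s i)) y ∧ R'' ≤ dist (γ (t i)) y := by
    intro i
    have hyx : dist y x = (ρ₁ + R₁) / 2 := hmr i₀
    rcases (hst i).2 with ⟨hs, ht⟩ | ⟨hs, ht⟩
    · exact ⟨le_dist_of_endpoint hyx (Or.inl hs), le_dist_of_endpoint hyx (Or.inr ht)⟩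
    · exact ⟨le_dist_of_endpoint hyx (Or.inr hs), le_dist_of_endpoint hyx (Or.inl ht)⟩
  refine ⟨y, hmr i₀, ?_⟩
  refine ⟨![s i₀, m i₀, s j₀, m j₀], ![m₁, t i₀, m₂, t j₀], ?_, ?_⟩
  · intro n
    fin_cases n
    · exact ⟨hsm₁, Or.inr ⟨(hfar i₀).1, hd₁.le⟩⟩
    · refine ⟨hmt i₀, Or.inl ⟨?_, (hfar i₀).2⟩⟩
      simp [hy]; exact hηpos.le
    · exact ⟨hsm₂, Or.inr ⟨(hfar j₀).1, hd₂'⟩⟩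
    · refine ⟨hmt j₀, Or.inl ⟨?_, (hfar j₀).2⟩⟩
      have : dist (γ (m j₀)) y ≤ η := by rw [dist_comm, hη]; exact hd.le
      simpa using this
  · have h01 : m₁ < m i₀ := hm₁m
    have h12 : t i₀ < s j₀ := hsep hij
    have h23 : m₂ < m j₀ := hm₂m
    have a1 : m i₀ ≤ t i₀ := hmt i₀
    have a2 : s j₀ ≤ m₂ := hsm₂
    intro a c hac
    fin_cases a <;> fin_cases c <;> simp at hac ⊢
    · exact h01
    · exact lt_of_lt_of_le (lt_of_le_of_lt (h01.le.trans a1) h12) le_rfl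
    · exact lt_of_lt_of_le (lt_of_le_of_lt ((h01.le.trans a1)) h12) (a2.trans h23.le)
    · exact h12
    · exact lt_of_lt_of_le h12 (a2.trans h23.le)
    · exact h23

end Pinch

/-! ## §2 First lemma (PROVED — ideator 2): per-shell tightness gives the crux bound
(conclusion deliberately UNFOLDED so that `ShellCrossingBound_of` is the only theorem of the file whose
conclusion is the crux by name). -/

/-- Per-shell tightness implies the crux's bound, with the shell-dependent threshold `k(x, ρ, R)` chosen
so that the tail is `≤ (ρ/R)^3`; then `K = 1`, `λ = 3 > 2`. [ideator 2, PROVED] -/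
theorem bound_of_perShellTight (h : PerShellTight) :
    ∀ (D : DobrushinDomain) (a b : ℝ → Site 2), SAW.IsEndpointApprox D a b →
      ∃ (k : ℂ → ℝ → ℝ → ℕ) (K lam δ₀ : ℝ), 2 < lam ∧ 0 < δ₀ ∧ ∀ δ ∈ Set.Ioc (0 : ℝ) δ₀,
        ∀ (x : ℂ) (ρ R : ℝ), δ ≤ ρ → ρ < R → R ≤ 1 →
          SAW.law D.carrier δ (a δ) (b δ)
            {γ | (⟨γ.walk.toCurve (meshPoint δ)⟩ : Curve ℂ).HasTraversals (k x ρ R) x ρ R}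
              ≤ ENNReal.ofReal (K * (ρ / R) ^ lam) := by
  intro D a b hab
  obtain ⟨δ₀, hδ₀, hT⟩ := h D a b hab
  classical
  let k : ℂ → ℝ → ℝ → ℕ := fun x ρ R =>
    if hh : 0 < ρ ∧ ρ < R then
      Classical.choose (hT x ρ R hh.1 hh.2 ((ρ / R) ^ (3 : ℝ))
        (Real.rpow_pos_of_pos (div_pos hh.1 (hh.1.trans hh.2)) 3))
    else 0
  refine ⟨k, 1, 3, δ₀, by norm_num, hδ₀, ?_⟩
  intro δ hδ x ρ R hδρ hρR hR1
  have hρ : 0 < ρ := lt_of_lt_of_le hδ.1 hδρ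
  have hh : 0 < ρ ∧ ρ < R := ⟨hρ, hρR⟩
  have hspec := Classical.choose_spec (hT x ρ R hh.1 hh.2 ((ρ / R) ^ (3 : ℝ))
    (Real.rpow_pos_of_pos (div_pos hh.1 (hh.1.trans hh.2)) 3)) δ hδ hδρ
  have hk : k x ρ R = Classical.choose (hT x ρ R hh.1 hh.2 ((ρ / R) ^ (3 : ℝ))
      (Real.rpow_pos_of_pos (div_pos hh.1 (hh.1.trans hh.2)) 3)) := by
    simp only [k, dif_pos hh]
  show SAW.law D.carrier δ (a δ) (b δ)
      {γ | (⟨γ.walk.toCurve (meshPoint δ)⟩ : Curve ℂ).HasTraversals (k x ρ R) x ρ R} ≤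
    ENNReal.ofReal (1 * (ρ / R) ^ (3 : ℝ))
  rw [one_mul, hk]
  exact hspec

/-! ## §3 The registered stubs (`sorry` lives ONLY in these six theorems; each restates its named
statement verbatim, `*_holds` below certify the agreement definitionally) -/

/-- **STUB A · `stub_subMeshNoPinch`** (size M, PROVABLE NOW; deterministic lattice geometry) —
`= SubMeshNoPinch`: a `δℤ²` SAW polyline makes at most two separate traversals of `D(y; η, R)` when
`η < δ/4` and `2η < R`.  Proof route in the docstring of `SubMeshNoPinch`.  Used by STUB B to absorb
`d`-dependent mesh thresholds (and reusable by every line that fixes a threshold). -/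
theorem stub_subMeshNoPinch :
    ∀ (Ω : Set ℂ) (δ : ℝ) (a b : Site 2) (γ : SAW.DomainSAW Ω δ a b) (y : ℂ) (η R : ℝ),
      0 < δ → η < δ / 4 → 2 * η < R →
        ¬ (⟨γ.walk.toCurve (meshPoint δ)⟩ : Curve ℂ).HasTraversals 3 y η R := by
  sorry

/-- **STUB B · `stub_pinchUnion`** (size M, PROVABLE NOW; the one-dimensional union bound) —
`SubMeshNoPinch → UniformTwoStrandPinch → PerShellTight`.  Proof: take `δ₀ := 1` in `PerShellTight`.
Given a shell `D(x; ρ, R)` and `ε > 0`: among the five radii `ρ + i(R-ρ)/6` one, `r`, has its circle at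
distance `≥ d := (R-ρ)/16` from both marked points (each marked point is that close to at most one of
them); set `ρ₁ := r - (R-ρ)/12`, `R₁ := r + (R-ρ)/12`, `R'' := (R₁-ρ₁)/2`; get `δ_d, C, s, R₀` from UTSP
at `d`; put `R* := min (R''/2) R₀`, `η_k := 5πr/k`, and choose `k ≥ 2` with `η_k < R*`,
`(k+1) C (η_k/R*)^{1+s} ≤ ε` (possible since `1 + s > 1`), `4πr/k < δ_d/4` and `8πr/k < R''`.
For `δ ≤ min δ_d ρ`: `k` traversals of `D(x;ρ,R)` ⇒ of `D(x;ρ₁,R₁)` (`HasTraversals.mono'`) ⇒ 4 of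
`D(y; 4πr/k, R'')`, `|y-x| = r` (`exists_pinch_of_hasTraversals`) ⇒ 4 of `D(y_j; η_k, R*)` for one of
`k+1` equally spaced net points `y_j` of the circle (`HasTraversals.mono`, `|y - y_j| ≤ πr/(k+1)`) ⇒
`travMass k ≤ Σ_j travMass 4 y_j η_k R* ≤ (k+1) C (η_k/R*)^{1+s} ≤ ε` (`measure_biUnion_finset_le`;
UTSP applies: `d ≤ dist y_j (pt i)`, `0 < η_k < R* ≤ R₀`, `δ ≤ δ_d`).  For `δ_d < δ ≤ ρ` (`δ ≤ 1`):
the same pinch gives `HasTraversals 4 ⇒ 3` of `D(y; 4πr/k, R'')` with `4πr/k < δ/4`, `2·(4πr/k) < R''`,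
impossible by `SubMeshNoPinch`, so the event is empty and its mass `0 ≤ ε`. -/
theorem stub_pinchUnion : SubMeshNoPinch → UniformTwoStrandPinch → PerShellTight := by
  sorry

/-- **STUB C · `stub_socketedEnlargement`** (size L, PROVABLE NOW; plane topology) —
`= SocketedEnlargement`.  Construction in the docstring of `SocketedEnlargement` (Schoenflies
`JordanDomain.exists_homeomorph_eqOn_frontier` / `exists_homeomorph_eqOn_closure` of
`Literature/Topology/PlaneTopology/`, a star-shaped Jordan domain with continuous radial function,
`MarkedDomain.map` / `pt_map` / `carrier_map` of `ChordalCurveFamily.lean`, compactness for `ε`). -/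
theorem stub_socketedEnlargement :
    ∀ (D : DobrushinDomain) (d : ℝ), 0 < d →
      ∃ (D' : DobrushinDomain) (ε : ℝ), 0 < ε ∧ D.carrier ⊆ D'.carrier ∧
        D'.pt 0 = D.pt 0 ∧ D'.pt 1 = D.pt 1 ∧
        D'.carrier ∩ (Metric.ball (D.pt 0) (d / 2) ∪ Metric.ball (D.pt 1) (d / 2)) ⊆ D.carrier ∧
        ∀ z ∈ closure D.carrier, d ≤ dist z (D.pt 0) → d ≤ dist z (D.pt 1) →
          Metric.closedBall z ε ⊆ D'.carrier := by
  sorry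

/-- **STUB D · `stub_socketTransfer`** (size M–L, PROVABLE NOW; restriction covariance on the lattice) —
`SocketedEnlargement → ConfinementPositivity → BulkTwoStrandPinch → UniformTwoStrandPinch`.
Proof: fix `D, a, b, hab, d`.  (1) `D' ⊇ D`, `ε`, sockets of radius `d/4`, room at distance `≥ d/2`
from `SocketedEnlargement D (d/2)`.  (2) Nesting: for `δ ≤ δ₃`, `discreteDomainGraph D.carrier δ ≤
discreteDomainGraph D'.carrier δ` (`meshGraph` is monotone in the closure; `meshDomain D δ` is one
component containing the mesh points of a fixed compact `K ⊆ D` and those lie in `meshDomain D' δ`,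
`JordanDomain.exists_forall_mem_meshDomain_and_reachable` for `D` and for `D'`,
`mem_meshDomain_of_reachable_meshVertexGraph`); hence `SAW.IsEndpointApprox D' a b`.  (3)
`BulkTwoStrandPinch D' a b` gives `δ₁, C, s, R₁`; `ConfinementPositivity D' D a b (d/4)` gives `c, δ₂`.
(4) Put `δ₀ := min δ₁ δ₂ δ₃`, `R₀ := min R₁ (ε/3) (d/4)`, constant `C/c`.  For `δ ≤ δ₀`, `y` at
distance `≥ d` from the marked points, `0 < η < R ≤ R₀`: if `η < infDist y (closure D)` the event is
empty (the polyline of a walk of `D_δ` lies in `closure D`: vertices in `D`, edges `⊆ closure D` by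
`meshGraph_adj_iff`; a traversal needs a point of the curve in `closedBall y η`), mass `0`.  Otherwise
pick `z ∈ closure D`, `dist y z ≤ η ≤ d/4`, so `dist z (pt i) ≥ d/2` and `closedBall y (2R) ⊆
closedBall z (3R₀) ⊆ closedBall z ε ⊆ D'`: the ball is INTERIOR in `D'`.  (5) Restriction covariance
(an identity of finite sums): `SimpleGraph.Walk.transfer` is a length- and polyline-preserving
bijection `DomainSAW D δ (a δ) (b δ) ≃ {γ' : DomainSAW D' δ (a δ) (b δ) // staysIn D.carrier δ γ'}`,
so `SAW.law D … E = SAW.law D' … (E ∩ staysIn) / SAW.law D' … staysIn ≤ travMass D' … / c ≤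
(C/c) (η/R)^{1+s}` (`SAW.law = (weight univ)⁻¹ • weight`, `weight_singleton`). -/
theorem stub_socketTransfer :
    SocketedEnlargement → ConfinementPositivity → BulkTwoStrandPinch → UniformTwoStrandPinch := by
  sorry

/-- **STUB E · `stub_confinementPositivity`** (size L–XL, OPEN; rate-free RSW-type lower bound at `x_c`)
— `= ConfinementPositivity`.  Why plausibly true: the sockets keep the boundary germs at `a, b` identical,
so `Z_{D'}(a_δ,b_δ)/Z_D(a_δ,b_δ)` is of order one and predicted to converge to the `SLE_{8/3}`
restriction constant `> 0` (LSW03); implied by `SAWScalingLimit`; band test of the crux's own measure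
matches the conformal prediction `0.332` (ToyDataIdeator2.md).  Why it might fail: it IS a lower bound
on a constrained critical partition function, and none is known on `ℤ²` at any scale
(DuminilCopinHammond2013 Question 2); without sockets it is false (power decay in `δ`). -/
theorem stub_confinementPositivity :
    ∀ (D D' : DobrushinDomain) (a b : ℝ → Site 2) (d : ℝ), 0 < d →
      D'.carrier ⊆ D.carrier → D'.pt 0 = D.pt 0 → D'.pt 1 = D.pt 1 →
      D.carrier ∩ (Metric.ball (D.pt 0) d ∪ Metric.ball (D.pt 1) d) ⊆ D'.carrier →
      SAW.IsEndpointApprox D' a b →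
        ∃ c δ₀ : ℝ, 0 < c ∧ 0 < δ₀ ∧ ∀ δ ∈ Set.Ioc (0 : ℝ) δ₀,
          ENNReal.ofReal c ≤ SAW.law D.carrier δ (a δ) (b δ) {γ | staysIn D'.carrier δ γ} := by
  sorry

/-- **STUB F · `stub_bulkTwoStrandPinch`** (size XL, OPEN — the HARDEST stub; the interior two-pinch /
4-leg bound with exponent `> 1` for the critical `ℤ²` SAW) — `= BulkTwoStrandPinch`.  Why plausibly
true: bulk watermelon exponent `x₄ = 35/12 ≫ 1`, and even two independent passages (`2x₂ = 4/3`) clear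
the threshold; BFACF slope `2.56` at mesh `1/64`.  Why it might fail: no arm bound of any kind is proved
for the planar SAW at `x_c` (KS17 §4 omits SAW; DC–Hammond give sub-ballisticity only; even
`G_{x_c}(e₁) < ∞` is open on `ℤ²`), and the constant must be uniform over the position of the ball in
the domain.  Engines on file (card pinch-on-a-circle §Transfer; not part of the registered statement):
(a) decoupling `P[two passes] ≤ P[pass] · sup' P[pass | first strand]` with each factor of exponent
`> 1/2`, the sup running over all but a negligible set of first strands; (b) two-sided `x_c`-Gibbs
resampling inside `B(y, 2R)` with TWO chords to price (HexTight cards rim-chords-price-one-pinch,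
radial-portal-transfer); (c) the route's surgery with one excision pair per strand (`2θ - C_tube > 1`,
r3 `AnnularMassDecay`, r4 `TubeLowerBound`). -/
theorem stub_bulkTwoStrandPinch :
    ∀ (D : DobrushinDomain) (a b : ℝ → Site 2), SAW.IsEndpointApprox D a b →
      ∃ (δ₀ C s R₀ : ℝ), 0 < δ₀ ∧ 0 < s ∧ 0 < R₀ ∧
        ∀ δ ∈ Set.Ioc (0 : ℝ) δ₀, ∀ (y : ℂ) (η R : ℝ),
          Metric.closedBall y (2 * R) ⊆ D.carrier → 0 < η → η < R → R ≤ R₀ →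
            travMass D a b δ 4 y η R ≤ ENNReal.ofReal (C * (η / R) ^ (1 + s)) := by
  sorry

/-! ### Consistency: each named statement IS its registered stub (definitionally) -/

theorem subMeshNoPinch_holds : SubMeshNoPinch := stub_subMeshNoPinch
theorem pinchUnion_holds : PinchUnion := stub_pinchUnion
theorem socketedEnlargement_holds : SocketedEnlargement := stub_socketedEnlargement
theorem socketTransfer_holds : SocketTransfer := stub_socketTransfer
theorem confinementPositivity_holds : ConfinementPositivity := stub_confinementPositivity
theorem bulkTwoStrandPinch_holds : BulkTwoStrandPinch := stub_bulkTwoStrandPinch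

/-! ### Name-keyed aliases of the six statements (the hypotheses of the composition) -/
namespace Registered

/-- Alias of `SubMeshNoPinch` keyed by the registered stub name. -/
abbrev stub_subMeshNoPinch : Prop := SubMeshNoPinch
/-- Alias of `PinchUnion` keyed by the registered stub name. -/
abbrev stub_pinchUnion : Prop := PinchUnion
/-- Alias of `SocketedEnlargement` keyed by the registered stub name. -/
abbrev stub_socketedEnlargement : Prop := SocketedEnlargement
/-- Alias of `SocketTransfer` keyed by the registered stub name. -/
abbrev stub_socketTransfer : Prop := SocketTransfer
/-- Alias of `ConfinementPositivity` keyed by the registered stub name. -/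
abbrev stub_confinementPositivity : Prop := ConfinementPositivity
/-- Alias of `BulkTwoStrandPinch` keyed by the registered stub name. -/
abbrev stub_bulkTwoStrandPinch : Prop := BulkTwoStrandPinch

end Registered

/-! ## §4 The composition: the six stubs imply the crux, BY NAME (kernel-checked; no `sorry` below) -/

/-- The hub of the line, assembled: the two open atoms and the two reductions give UTSP, and UTSP with
sub-mesh emptiness gives per-shell tightness. -/
theorem perShellTight_of (hA : SubMeshNoPinch) (hB : PinchUnion) (hC : SocketedEnlargement)
    (hD : SocketTransfer) (hE : ConfinementPositivity) (hF : BulkTwoStrandPinch) : PerShellTight :=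
  hB hA (hD hC hE hF)

/-- **`ShellCrossingBound_of`** — the glue of the line: STUBS A–F imply the crux
`SAWRenewalTightness.ShellCrossingBound` by name (`perShellTight_of` + the PROVED first lemma
`bound_of_perShellTight`, `K = 1`, `λ = 3`). -/
theorem ShellCrossingBound_of (hA : Registered.stub_subMeshNoPinch) (hB : Registered.stub_pinchUnion)
    (hC : Registered.stub_socketedEnlargement) (hD : Registered.stub_socketTransfer)
    (hE : Registered.stub_confinementPositivity) (hF : Registered.stub_bulkTwoStrandPinch) :
    Summit.CriticalPhenomena.SAWScalingLimit.Theses.SAWRenewalTightness.ShellCrossingBound :=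
  fun D a b hab => bound_of_perShellTight (perShellTight_of hA hB hC hD hE hF) D a b hab

/-- Wiring check: the registered stubs feed `ShellCrossingBound_of` as stated. -/
example : Summit.CriticalPhenomena.SAWScalingLimit.Theses.SAWRenewalTightness.ShellCrossingBound :=
  ShellCrossingBound_of stub_subMeshNoPinch stub_pinchUnion stub_socketedEnlargement
    stub_socketTransfer stub_confinementPositivity stub_bulkTwoStrandPinch

end Summit.CriticalPhenomena.SAWScalingLimit.Cruxes.ShellCrossingBound.PinchOnACircle

end
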